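import Summits.ValiantsHypothesis.ValiantsHypothesis.Theorems.BarrierLeverChowHitsThinRowPartitionMinorsRBigStar
import Summits.ValiantsHypothesis.ValiantsHypothesis.Theorems.BarrierLeverChowHitsThinRowPartitionMinorsRStar
import Summits.ValiantsHypothesis.ValiantsHypothesis.Theorems.BarrierLeverChowHitsThinRowPartitionMinorsRNearFull
import Summits.ValiantsHypothesis.ValiantsHypothesis.Theorems.BarrierLeverChowHitsThinRowPartitionMinorsRSlices

/-!
# Route BarrierLever — item `ChowHitsThinRowPartitionMinorsR` (stmt-ValiantsHypothesis-21850) PROVED: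
# every thin layout is hit by `h·h` affine forms (`h ≥ 5`)

Cell valiant-natproofs, rung V4, 𝒟-side; seat val-np-p5 gen 28.  Definition-free; imports this seat's
`…RBigStar`, `…RStar`, `…RNearFull`, `…RSlices`.

* `sum_card_eq_sum_deg` — double counting `Σ_j |U j| = Σ_v deg v`, `deg v = #{j : v ∈ U j}`.
* **`chowHitsHH_of_nearFull`** — every NEAR-FULL thin layout (`h·h < #singles + h + 2·#pairs`,
  `u`, `w` injective, `h ≥ 5`) is hit.  Proof: take any down-closed injective monomial basis `U` of the
  columns (`ChowThinAll.exists_downClosed_monomialBasis`), `n := #SLab ≥ 1` singleton labels, and the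
  vertex `v₀` of maximal degree `deg v₀` in `U`; double counting gives `n·deg v₀ ≥ Σ_j |U j| ≥ 2r − n − 2`
  and `r ≥ #singles + #pairs`, whence `D := #{j : v₀ ∈ U j, |U j| ≥ 2} ≥ (#singles − n)/2` for `h ≥ 5`.
  Near-full rows contain a FULL STAR (`exists_fullStar_of_nearFull`); x-dedicating `k := min(#singles − 1, D)`
  of its pair rows with labels `T ∋ v₀` (`chowHitsHH_of_xdedBigStar`) costs
  `≤ max(|Cu| + 2p − k, |Cu| + s − n + 2p − 2k) ≤ h·h` forms.  No absorption, no `s`-asymptotics: the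
  conjectured analytic certificate (memo AC″) is not needed.
* **`chowHitsThinRowPartitionMinorsR_proof : ChowHitsThinRowPartitionMinorsR`** — the item, with
  `h₀ = 5`: the complementary range `#singles + h + 2·#pairs ≤ h·h` is `chowHitsHH_of_card` (p689058).
  Consequently the registered residual stubs of line `antipodal_gadget` (`stub_fullPairs`,
  `stub_missingPairs`) and the node `Stmt.stub_leaveOut` hold a fortiori.

WHAT THIS IS NOT: item 21850 is a SUPPORT item of route BarrierLever (the h·h-budget Chow-hitting
property for thin row partitions); nothing here bears on items 21882 / 19717, on crux
stmt-ValiantsHypothesis-14610, or on `VP` versus `VNP`.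
-/

set_option linter.dupNamespace false

namespace Summit.ValiantsHypothesis.ValiantsHypothesis.Theorems.BarrierLever.ChowThinHH

open Finset MvPolynomial
open Summit.ValiantsHypothesis.ValiantsHypothesis.Theses.BarrierLever (ChowHitsThinRowPartitionMinorsR)

variable {h r : ℕ}

/-- Double counting: `Σ_j |U j| = Σ_v #{j : v ∈ U j}`. -/
theorem sum_card_eq_sum_deg (U : Fin r → Finset (Fin h)) :
    ∑ j, (U j).card = ∑ v : Fin h, (Finset.univ.filter fun j : Fin r => v ∈ U j).card := by
  classical
  have h1 : ∀ j, (U j).card = ∑ v : Fin h, if v ∈ U j then 1 else 0 := fun j => by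
    rw [Finset.sum_ite_mem, Finset.univ_inter, Finset.sum_const, smul_eq_mul, mul_one]
  have h2 : ∀ v : Fin h, (Finset.univ.filter fun j : Fin r => v ∈ U j).card =
      ∑ j : Fin r, if v ∈ U j then 1 else 0 := fun v => by
    rw [Finset.sum_boole]; simp
  simp_rw [h1, h2]
  exact Finset.sum_comm

/-- **Every near-full thin layout is hit** (`h ≥ 5`; see the module docstring). -/
theorem chowHitsHH_of_nearFull (h r : ℕ) (u w : Fin r → Finset (Fin h))
    (hu : Function.Injective u) (hw : Function.Injective w) (hu2 : ∀ i, (u i).card ≤ 2)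
    (h5 : 5 ≤ h)
    (hnear : h * h < (Finset.univ.filter fun i : Fin r => (u i).card = 1).card + h +
      2 * (Finset.univ.filter fun i : Fin r => (u i).card = 2).card) :
    ∃ ℓ : Fin (h * h) → MvPolynomial (Fin (h + h)) ℂ, (∀ k, (ℓ k).totalDegree ≤ 1) ∧
      (Matrix.of fun i j : Fin r => MvPolynomial.coeff
        (∑ a ∈ u i, Finsupp.single (Fin.castAdd h a) 1 +
          ∑ c ∈ w j, Finsupp.single (Fin.natAdd h c) 1) (∏ k, ℓ k)).det ≠ 0 := by
  classical
  obtain ⟨U, hUinj, hUdown, hZ⟩ := ChowThinAll.exists_downClosed_monomialBasis w hw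
  set Sing : Finset (Fin r) := Finset.univ.filter fun i : Fin r => (u i).card = 1 with hSing
  set Pairs : Finset (Fin r) := Finset.univ.filter fun i : Fin r => (u i).card = 2 with hPairs
  set SLab : Finset (Fin r) := Finset.univ.filter fun j : Fin r => (U j).card = 1 with hSLab
  set Cu : Finset (Fin h) := Finset.univ.biUnion w with hCu
  have hcard : Sing.card + Pairs.card ≤ r := card_singles_add_pairs_le u
  have hC := add_two_mul_choose_two h
  have hp : Pairs.card ≤ h.choose 2 := card_pairRows_le u hu
  have hSing_le : Sing.card ≤ h := by
    rw [← Finset.card_image_of_injective _ hu]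
    refine (Finset.card_le_card ?_).trans
      (Finset.card_image_le.trans (by rw [Finset.card_univ, Fintype.card_fin]) :
        (Finset.univ.image fun c : Fin h => ({c} : Finset (Fin h))).card ≤ h)
    intro S hS
    obtain ⟨i, hi, rfl⟩ := Finset.mem_image.mp hS
    obtain ⟨c, hc⟩ := Finset.card_eq_one.mp (Finset.mem_filter.mp hi).2
    exact Finset.mem_image.mpr ⟨c, Finset.mem_univ _, hc.symm⟩
  have hCu_h : Cu.card ≤ h := (Finset.card_le_univ _).trans (by rw [Fintype.card_fin])
  have hh5 : 5 * h ≤ h * h := Nat.mul_le_mul_right h h5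
  have hs1 : 1 ≤ Sing.card := by omega
  have hr2 : 2 ≤ r := by omega
  -- a singleton label exists; `V` = coordinates carrying singleton labels, `n = |V| = #SLab ≥ 1`
  obtain ⟨j1, hj1⟩ : ∃ j, U j ≠ ∅ := by
    by_contra hno
    simp only [not_exists, not_not] at hno
    have e := hUinj ((hno ⟨0, by omega⟩).trans (hno ⟨1, by omega⟩).symm)
    simp [Fin.ext_iff] at e
  obtain ⟨c1, hc1⟩ := Finset.nonempty_iff_ne_empty.mpr hj1
  obtain ⟨j2, hj2⟩ := hUdown j1 {c1} (Finset.singleton_subset_iff.mpr hc1)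
  have hj2S : j2 ∈ SLab := Finset.mem_filter.mpr ⟨Finset.mem_univ _, by rw [hj2, Finset.card_singleton]⟩
  set V : Finset (Fin h) := SLab.biUnion U with hV
  have hVcard : V.card = SLab.card := by
    rw [hV, Finset.card_biUnion]
    · calc ∑ j ∈ SLab, (U j).card = ∑ j ∈ SLab, 1 :=
            Finset.sum_congr rfl fun j hj => (Finset.mem_filter.mp hj).2
        _ = SLab.card := by simp
    · intro i hi j hj hij
      obtain ⟨a, ha⟩ := Finset.card_eq_one.mp (Finset.mem_filter.mp hi).2
      obtain ⟨b, hb⟩ := Finset.card_eq_one.mp (Finset.mem_filter.mp hj).2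
      show Disjoint (U i) (U j)
      rw [ha, hb, Finset.disjoint_singleton]
      intro e
      exact hij (hUinj (by rw [ha, hb, e]))
  have hmemV : ∀ v, v ∈ V ↔ ∃ j, U j = {v} := by
    intro v
    constructor
    · intro hv
      obtain ⟨j, hj, hvj⟩ := Finset.mem_biUnion.mp hv
      obtain ⟨c, hc⟩ := Finset.card_eq_one.mp (Finset.mem_filter.mp hj).2
      rw [hc, Finset.mem_singleton] at hvj
      exact ⟨j, by rw [hc, hvj]⟩
    · rintro ⟨j, hj⟩
      exact Finset.mem_biUnion.mpr ⟨j, Finset.mem_filter.mpr ⟨Finset.mem_univ _, by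
        rw [hj, Finset.card_singleton]⟩, by rw [hj]; exact Finset.mem_singleton_self v⟩
  have hVne : V.Nonempty := ⟨c1, (hmemV c1).mpr ⟨j2, hj2⟩⟩
  have hV_h : V.card ≤ h := (Finset.card_le_univ _).trans (by rw [Fintype.card_fin])
  have hn1 : 1 ≤ SLab.card := by rw [← hVcard]; exact Finset.card_pos.mpr hVne
  -- the vertex of maximal degree
  set deg : Fin h → ℕ := fun v => (Finset.univ.filter fun j : Fin r => v ∈ U j).card with hdeg
  obtain ⟨v₀, hv₀V, hmax⟩ := Finset.exists_max_image V deg hVne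
  obtain ⟨j₀, hj₀⟩ := (hmemV v₀).mp hv₀V
  have hdeg0 : ∀ v, v ∉ V → deg v = 0 := by
    intro v hv
    simp only [hdeg, Finset.card_eq_zero, Finset.filter_eq_empty_iff]
    intro j _ hvj
    obtain ⟨j', hj'⟩ := hUdown j {v} (Finset.singleton_subset_iff.mpr hvj)
    exact hv ((hmemV v).mpr ⟨j', hj'⟩)
  have hsum_le : ∑ j, (U j).card ≤ SLab.card * deg v₀ := by
    rw [sum_card_eq_sum_deg, ← Finset.sum_subset (Finset.subset_univ V) (fun v _ hv => hdeg0 v hv),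
      ← hVcard]
    exact (Finset.sum_le_sum fun v hv => hmax v hv).trans (by rw [Finset.sum_const, smul_eq_mul])
  have hsum_ge : 2 * r ≤ ∑ j, (U j).card + SLab.card + 2 := by
    have hpt : ∀ j, 2 ≤ (U j).card + (if j ∈ SLab then 1 else 0) +
        2 * (if U j = ∅ then 1 else 0) := by
      intro j
      by_cases h0 : U j = ∅
      · simp [h0]
      · have hne : (U j).card ≠ 0 := by rwa [Ne, Finset.card_eq_zero]
        by_cases h1 : j ∈ SLab
        · have h1' : (U j).card = 1 := (Finset.mem_filter.mp h1).2
          simp [h1, h1', h0]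
        · have h1' : (U j).card ≠ 1 := fun e => h1 (Finset.mem_filter.mpr ⟨Finset.mem_univ _, e⟩)
          simp only [h1, h0, if_false]; omega
    have hs := Finset.sum_le_sum fun j (_ : j ∈ (Finset.univ : Finset (Fin r))) => hpt j
    rw [Finset.sum_const, Finset.card_univ, Fintype.card_fin, smul_eq_mul, Finset.sum_add_distrib,
      Finset.sum_add_distrib, ← Finset.mul_sum, Finset.sum_ite_mem, Finset.univ_inter, Finset.sum_const,
      smul_eq_mul, mul_one, Finset.sum_boole] at hs
    simp only [Nat.cast_id] at hs
    have hE : (Finset.univ.filter fun j : Fin r => U j = ∅).card ≤ 1 :=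
      Finset.card_le_one.mpr fun a ha b hb =>
        hUinj ((Finset.mem_filter.mp ha).2.trans (Finset.mem_filter.mp hb).2.symm)
    omega
  -- the supply of labels through `v₀`
  set Fbig : Finset (Fin r) := Finset.univ.filter fun j : Fin r => v₀ ∈ U j ∧ 2 ≤ (U j).card with hFbig
  set D : ℕ := Fbig.card with hD
  have hdegD : deg v₀ ≤ D + 1 := by
    have hsub : (Finset.univ.filter fun j : Fin r => v₀ ∈ U j) ⊆ Fbig ∪ {j₀} := by
      intro j hj
      have hvj := (Finset.mem_filter.mp hj).2
      by_cases h2 : 2 ≤ (U j).card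
      · exact Finset.mem_union_left _ (Finset.mem_filter.mpr ⟨Finset.mem_univ _, hvj, h2⟩)
      · refine Finset.mem_union_right _ (Finset.mem_singleton.mpr (hUinj ?_))
        rw [hj₀]
        have hle : (U j).card ≤ 1 := by omega
        obtain ⟨c, hc⟩ := Finset.card_eq_one.mp (le_antisymm hle (Finset.card_pos.mpr ⟨v₀, hvj⟩))
        rw [hc] at hvj ⊢
        rw [Finset.mem_singleton.mp hvj]
    calc deg v₀ ≤ (Fbig ∪ {j₀}).card := Finset.card_le_card hsub
      _ ≤ Fbig.card + 1 := (Finset.card_union_le _ _).trans (by rw [Finset.card_singleton])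
  -- the row star
  obtain ⟨i₀, hi₀, hstar⟩ := exists_fullStar_of_nearFull u hu hnear
  obtain ⟨a₀, ha₀⟩ := Finset.card_eq_one.mp hi₀
  set A' : Finset (Fin h) := (Sing.erase i₀).biUnion u with hA'
  have hi₀S : i₀ ∈ Sing := Finset.mem_filter.mpr ⟨Finset.mem_univ _, hi₀⟩
  have hA'card0 : A'.card = (Sing.erase i₀).card := by
    rw [hA', Finset.card_biUnion]
    · calc ∑ i ∈ Sing.erase i₀, (u i).card = ∑ i ∈ Sing.erase i₀, 1 :=
            Finset.sum_congr rfl fun i hi => (Finset.mem_filter.mp (Finset.mem_of_mem_erase hi)).2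
        _ = (Sing.erase i₀).card := by simp
    · intro i hi j hj hij
      obtain ⟨a, ha⟩ := Finset.card_eq_one.mp (Finset.mem_filter.mp (Finset.mem_of_mem_erase hi)).2
      obtain ⟨b, hb⟩ := Finset.card_eq_one.mp (Finset.mem_filter.mp (Finset.mem_of_mem_erase hj)).2
      show Disjoint (u i) (u j)
      rw [ha, hb, Finset.disjoint_singleton]
      intro e
      exact hij (hu (by rw [ha, hb, e]))
  have hA'card : A'.card = Sing.card - 1 := by rw [hA'card0, Finset.card_erase_of_mem hi₀S]
  have hA'row : ∀ x ∈ A', ∃ i, u i = {x} ∧ i ≠ i₀ := by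
    intro x hx
    obtain ⟨i, hi, hxi⟩ := Finset.mem_biUnion.mp hx
    obtain ⟨x', hx'⟩ := Finset.card_eq_one.mp (Finset.mem_filter.mp (Finset.mem_of_mem_erase hi)).2
    rw [hx'] at hxi
    exact ⟨i, by rw [hx', Finset.mem_singleton.mp hxi], Finset.ne_of_mem_erase hi⟩
  have ha₀A' : a₀ ∉ A' := by
    intro hx
    obtain ⟨i, hi, hne⟩ := hA'row a₀ hx
    exact hne (hu (hi.trans ha₀.symm))
  -- `k` leaves and `k` labels through `v₀`
  set k : ℕ := min (Sing.card - 1) D with hk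
  obtain ⟨B, hBA', hBcard⟩ := Finset.exists_subset_card_eq (show k ≤ A'.card by
    rw [hA'card]; exact min_le_left _ _)
  have haB : a₀ ∉ B := fun hx => ha₀A' (hBA' hx)
  set TT : Finset (Finset (Fin h)) := Fbig.image U with hTT
  have hTTcard : TT.card = D := by rw [hTT, Finset.card_image_of_injective _ hUinj]
  obtain ⟨TT', hTT'sub, hTT'card⟩ := Finset.exists_subset_card_eq (show k ≤ TT.card by
    rw [hTTcard]; exact min_le_right _ _)
  have hcardBT : Fintype.card B = Fintype.card TT' := by
    rw [Fintype.card_coe, Fintype.card_coe, hBcard, hTT'card]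
  set eBT : B ≃ TT' := Fintype.equivOfCardEq hcardBT with heBT
  set T : Fin h → Finset (Fin h) := fun x => if hx : x ∈ B then (eBT ⟨x, hx⟩ : Finset (Fin h)) else ∅
    with hTdef
  have hTmem : ∀ x ∈ B, T x ∈ Fbig.image U := fun x hx => by
    simp only [hTdef, dif_pos hx]; exact hTT'sub (eBT ⟨x, hx⟩).2
  have hTfacts : ∀ x ∈ B, (∃ j, U j = T x) ∧ v₀ ∈ T x ∧ 2 ≤ (T x).card := by
    intro x hx
    obtain ⟨j, hj, hjx⟩ := Finset.mem_image.mp (hTmem x hx)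
    have hj' := (Finset.mem_filter.mp hj).2
    exact ⟨⟨j, hjx⟩, hjx ▸ hj'.1, hjx ▸ hj'.2⟩
  have hTinj : Set.InjOn T B := by
    intro x hx x' hx' e
    simp only [Finset.mem_coe] at hx hx'
    simp only [hTdef, dif_pos hx, dif_pos hx'] at e
    have := eBT.injective (Subtype.ext e)
    exact congrArg Subtype.val this
  -- row maps
  have hσex : ∀ x ∈ insert a₀ B, ∃ i, u i = {x} := by
    intro x hx
    rcases Finset.mem_insert.mp hx with rfl | hx
    · exact ⟨i₀, ha₀⟩
    · obtain ⟨i, hi, -⟩ := hA'row x (hBA' hx); exact ⟨i, hi⟩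
  set σ : Fin h → Fin r := fun x => if hx : ∃ i, u i = {x} then Classical.choose hx else i₀ with hσdef
  have hσ : ∀ x ∈ insert a₀ B, u (σ x) = {x} := by
    intro x hx
    simp only [hσdef, dif_pos (hσex x hx)]
    exact Classical.choose_spec (hσex x hx)
  have hρex : ∀ x ∈ B, ∃ q, u q = {a₀, x} := by
    intro x hx
    obtain ⟨i, hi, hne⟩ := hA'row x (hBA' hx)
    obtain ⟨q, hq⟩ := hstar i (by rw [hi, Finset.card_singleton]) hne
    exact ⟨q, by rw [hq, ha₀, hi]; rfl⟩
  set ρ : Fin h → Fin r := fun x => if hx : ∃ q, u q = {a₀, x} then Classical.choose hx else i₀ with hρdef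
  have hρ : ∀ x ∈ B, u (ρ x) = {a₀, x} := by
    intro x hx
    simp only [hρdef, dif_pos (hρex x hx)]
    exact Classical.choose_spec (hρex x hx)
  refine chowHitsHH_of_xdedBigStar h r u w hu hu2 U hUinj hUdown hZ a₀ B haB σ hσ ρ hρ v₀ ⟨j₀, hj₀⟩
    T (fun x hx => (hTfacts x hx).1) (fun x hx => (hTfacts x hx).2.1) (fun x hx => (hTfacts x hx).2.2)
    hTinj ?_
  -- the budget inequality `|Cu| + s + 2p ≤ n + 2k + h·h`
  show Cu.card + Sing.card + 2 * Pairs.card ≤ SLab.card + 2 * B.card + h * h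
  rw [hBcard]
  have hND : SLab.card * deg v₀ ≤ SLab.card * D + SLab.card := by
    have := Nat.mul_le_mul_left SLab.card hdegD
    rwa [Nat.mul_succ] at this
  rcases Nat.lt_or_ge D (Sing.card - 1) with hlt | hge
  · -- `k = D`: show `s ≤ n + 2D` by double counting
    have hkD : k = D := by rw [hk, min_eq_right hlt.le]
    rw [hkD]
    by_contra hcon
    have hcon' : SLab.card + 2 * D + 1 ≤ Sing.card := by omega
    have hprod : SLab.card * (2 * D + SLab.card + 1) ≤ SLab.card * Sing.card :=
      Nat.mul_le_mul_left SLab.card (by omega)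
    have e1 : SLab.card * (2 * D + SLab.card + 1) =
        2 * (SLab.card * D) + SLab.card * SLab.card + SLab.card := by ring
    rw [e1] at hprod
    have hsq : 4 * (SLab.card * Sing.card) ≤ Sing.card * Sing.card + 4 * (SLab.card * SLab.card) := by
      have hz : (4 : ℤ) * ((SLab.card : ℤ) * (Sing.card : ℤ)) ≤
          (Sing.card : ℤ) * (Sing.card : ℤ) + 4 * ((SLab.card : ℤ) * (SLab.card : ℤ)) := by
        nlinarith [sq_nonneg ((Sing.card : ℤ) - 2 * (SLab.card : ℤ))]
      exact_mod_cast hz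
    have hss : Sing.card * Sing.card ≤ h * h := Nat.mul_le_mul hSing_le hSing_le
    have hn_h : SLab.card ≤ h := by rw [← hVcard]; exact hV_h
    omega
  · -- `k = s − 1`
    have hks : k = Sing.card - 1 := by rw [hk, min_eq_left hge]
    rw [hks]
    omega

/-- **Item stmt-ValiantsHypothesis-21850 (`ChowHitsThinRowPartitionMinorsR`, rank 9) — proved** with
`h₀ = 5`: few incidences by `chowHitsHH_of_card`, near-full rows by `chowHitsHH_of_nearFull`. -/
theorem chowHitsThinRowPartitionMinorsR_proof : ChowHitsThinRowPartitionMinorsR := by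
  classical
  refine ⟨5, fun h hh r u w hu hw hu2 => ?_⟩
  by_cases hb : (Finset.univ.filter fun i : Fin r => (u i).card = 1).card + h +
      2 * (Finset.univ.filter fun i : Fin r => (u i).card = 2).card ≤ h * h
  · exact chowHitsHH_of_card h r u w hu hw hu2 hb
  · exact chowHitsHH_of_nearFull h r u w hu hw hu2 hh (Nat.lt_of_not_le hb)

end Summit.ValiantsHypothesis.ValiantsHypothesis.Theorems.BarrierLever.ChowThinHH
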